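import Summits.Ventures.CertifiedArithmetic.LowPrec.Exact
import Mathlib.Algebra.BigOperators.Ring.Finset
import Mathlib.Algebra.Order.BigOperators.Group.Finset

/-!
# MX (microscaling) blocks: shared `E8M0` scale times `k` minifloat elements

HONEST FRAMING (venture CertifiedArithmetic / cell `pub-lowprec`): certified error envelopes and
provably optimal rounding/accumulation schemes for low-precision formats under stated cost models;
every table by two implementations; no hardware or vendor claims.

An MX block is a shared scale `X` (format `E8M0`: an 8-bit exponent code `e ≤ 254` with value
`2^(e-127)`; code `255` is NaN and is not a datum here) and `k` elements `P_i` of one element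
format; it denotes the `k` rationals `X · P_i` [RouhaniEtAl2023MX, §2, Fig. 1, Table 1 (k = 32,
elements FP8/FP6/FP4/INT8); OCP MX v1.0 §5]. This file types the block, its values, and the exact
dot product of two blocks, and proves the structural fact behind every accumulation analysis of
MX GEMMs: the element dot product `∑ P_i Q_i` is an INTEGER multiple of `quantum_φ · quantum_ψ`
bounded by `k · max_φ · max_ψ` quanta (`MXBlock.exists_int_elemDot`), hence exactly representable
in any accumulator format with enough precision and range (`MXBlock.exists_toRat_eq_elemDot`;
instances: the element dot product of one MXFP4 (`E2M1`) or MXFP6 (`E3M2`, `E2M3`) block pair with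
`k = 32` is a `binary32` value — FP32 accumulation of one such block product is exact; for MXFP8
blocks the bound `32 · max²` exceeds `2^24` and no such statement holds).
-/

namespace Literature.ComputerArithmetic.FloatingPoint

open Finset

/-- The MX shared-scale format `E8M0`: exponent code `0 … 254` (code `255` = NaN excluded),
value `2^(code - 127)`; no sign, no significand, no zero. [cite: RouhaniEtAl2023MX, §2.2] -/
structure E8M0 where
  /-- biased exponent code -/
  code : ℕ
  /-- codes `0 … 254` are numbers (`255` is NaN) -/
  code_le : code ≤ 254
  deriving DecidableEq

namespace E8M0

/-- Value `2^(code - 127)` of an `E8M0` scale. [cite: RouhaniEtAl2023MX, §2.2] -/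
def toRat (e : E8M0) : ℚ := (2 : ℚ) ^ ((e.code : ℤ) - 127)

/-- Scales are positive. [folklore] -/
theorem toRat_pos (e : E8M0) : 0 < e.toRat := by unfold toRat; exact zpow_pos (by norm_num) _

/-- The unit scale (code `127`, value `1`). [cite: RouhaniEtAl2023MX, §2.2] -/
def one : E8M0 := ⟨127, by decide⟩

/-- `one` has value `1`. [folklore] -/
@[simp] theorem toRat_one : one.toRat = 1 := by simp [toRat, one]

/-- `E8M0` is (computably) equivalent to `Fin 255`. [folklore] -/
def equivFin : E8M0 ≃ Fin 255 where
  toFun e := ⟨e.code, Nat.lt_succ_of_le e.code_le⟩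
  invFun i := ⟨i, Nat.le_of_lt_succ i.isLt⟩
  left_inv e := by cases e; rfl
  right_inv i := by cases i; rfl

/-- `E8M0` has 255 data. [cite: RouhaniEtAl2023MX, §2.2] -/
instance instFintype : Fintype E8M0 := Fintype.ofEquiv _ equivFin.symm

end E8M0

/-- An MX block of `k` elements of format `φ` sharing one `E8M0` scale.
[cite: RouhaniEtAl2023MX, §2] -/
structure MXBlock (φ : Format) (k : ℕ) where
  /-- shared scale `X` -/
  scale : E8M0
  /-- the `k` elements `P_i` -/
  elem : Fin k → MiniFloat φ

namespace MXBlock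

variable {φ ψ : Format} {k : ℕ}

/-- The `i`-th value `X · P_i` of a block. [cite: RouhaniEtAl2023MX, §2] -/
def val (b : MXBlock φ k) (i : Fin k) : ℚ := b.scale.toRat * (b.elem i).toRat

/-- Element dot product `∑ P_i · Q_i` (no scales). [folklore] -/
def elemDot (a : MXBlock φ k) (b : MXBlock ψ k) : ℚ := ∑ i, (a.elem i).toRat * (b.elem i).toRat

/-- Exact dot product `∑ (X P_i) · (Y Q_i)` of two blocks, as a rational. [cite: RouhaniEtAl2023MX, §2] -/
def dot (a : MXBlock φ k) (b : MXBlock ψ k) : ℚ := ∑ i, a.val i * b.val i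

/-- The dot product factors through the scales: `dot a b = X · Y · ∑ P_i Q_i` — the form in which
MX hardware/software evaluates it. [cite: RouhaniEtAl2023MX, §2] -/
theorem dot_eq_scale_mul_elemDot (a : MXBlock φ k) (b : MXBlock ψ k) :
    dot a b = a.scale.toRat * b.scale.toRat * elemDot a b := by
  unfold dot elemDot val
  rw [Finset.mul_sum]
  refine Finset.sum_congr rfl fun i _ => ?_
  ring

/-- STRUCTURE OF THE ELEMENT DOT PRODUCT: `∑ P_i Q_i = N · 2^(qexp_φ + qexp_ψ)` for an integer `N`
with `|N| ≤ k · max_φ · max_ψ` (in quanta). [folklore] -/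
theorem exists_int_elemDot (a : MXBlock φ k) (b : MXBlock ψ k) :
    ∃ N : ℤ, elemDot a b = (N : ℚ) * (2 : ℚ) ^ (φ.qexp + ψ.qexp) ∧
      |N| ≤ (k * (φ.maxScaled * ψ.maxScaled) : ℕ) := by
  refine ⟨∑ i, (a.elem i).toInt * (b.elem i).toInt, ?_, ?_⟩
  · unfold elemDot
    push_cast
    rw [Finset.sum_mul]
    exact Finset.sum_congr rfl fun i _ => by rw [MiniFloat.toRat_mul_toRat]; push_cast; ring
  · calc |∑ i, (a.elem i).toInt * (b.elem i).toInt|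
        ≤ ∑ i, |(a.elem i).toInt * (b.elem i).toInt| := Finset.abs_sum_le_sum_abs _ _
      _ ≤ ∑ _i : Fin k, ((φ.maxScaled * ψ.maxScaled : ℕ) : ℤ) := by
          refine Finset.sum_le_sum fun i _ => ?_
          rw [abs_mul, ← Int.natCast_natAbs, ← Int.natCast_natAbs, MiniFloat.natAbs_toInt,
            MiniFloat.natAbs_toInt]
          exact_mod_cast Nat.mul_le_mul (a.elem i).scaledMag_le_maxScaled
            (b.elem i).scaledMag_le_maxScaled
      _ = (k * (φ.maxScaled * ψ.maxScaled) : ℕ) := by simp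

/-- EXACT ACCUMULATION CRITERION: if an accumulator format `α` has `k · max_φ · max_ψ · 2^d ≤
max_α` quanta with `k · max_φ · max_ψ · 2^d < 2^(m_α + 1)` (the whole sum fits the significand)
where `quantum_φ · quantum_ψ = 2^d · quantum_α`, then the element dot product of ANY two blocks is
the value of a finite datum of `α` (so an exact accumulator of that width incurs no rounding).
[folklore] -/
theorem exists_toRat_eq_elemDot {α : Format} {d : ℕ} (hq : φ.qexp + ψ.qexp = α.qexp + d)
    (hsig : k * (φ.maxScaled * ψ.maxScaled) < 2 ^ (α.manBits + 1))
    (hr : k * (φ.maxScaled * ψ.maxScaled) * 2 ^ d ≤ α.maxScaled)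
    (a : MXBlock φ k) (b : MXBlock ψ k) : ∃ z : MiniFloat α, z.toRat = elemDot a b := by
  obtain ⟨N, hN, hNle⟩ := exists_int_elemDot a b
  have hNle' : N.natAbs ≤ k * (φ.maxScaled * ψ.maxScaled) := by
    have := Int.abs_eq_natAbs N; omega
  have hle : N.natAbs * 2 ^ d ≤ α.maxScaled := le_trans (Nat.mul_le_mul_right _ hNle') hr
  have hrep : α.Representable (N.natAbs * 2 ^ d) :=
    MiniFloat.representable_mul_pow (lt_of_le_of_lt hNle' hsig) hle
  refine ⟨MiniFloat.ofScaled α (decide (N < 0)) _ hle, ?_⟩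
  rw [MiniFloat.toRat_ofScaled hle hrep, hN, hq, Format.quantum,
    zpow_add₀ (by norm_num : (2 : ℚ) ≠ 0), zpow_natCast]
  have hcast : ((N.natAbs : ℕ) : ℚ) = |(N : ℚ)| := by rw [Nat.cast_natAbs, Int.cast_abs]
  by_cases hN0 : N < 0
  · have hN0' : (N : ℚ) < 0 := by exact_mod_cast hN0
    rw [if_pos (by simpa using hN0)]
    push_cast
    rw [hcast, abs_of_neg hN0']
    ring
  · have hN0' : (0 : ℚ) ≤ N := by exact_mod_cast not_lt.mp hN0
    rw [if_neg (by simpa using hN0)]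
    push_cast
    rw [hcast, abs_of_nonneg hN0']
    ring

/-- INSTANCE: the element dot product of two MXFP4 blocks (`E2M1`, `k = 32`) is a `binary32`
value (`|N| ≤ 32 · 12 · 12 = 4608 < 2^24` quanta of `2^-2`): FP32 accumulation of one MXFP4 block
product is exact. [folklore] -/
theorem E2M1_elemDot_exact_in_Binary32 (a b : MXBlock Format.E2M1 32) :
    ∃ z : MiniFloat Format.Binary32, z.toRat = elemDot a b :=
  exists_toRat_eq_elemDot (d := 147) (by decide) (by decide +kernel) (by decide +kernel) a b

/-- INSTANCE: the element dot product of two MXFP6 `E3M2` blocks (`k = 32`) is a `binary32` value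
(`32 · 448² = 6422528 < 2^24` quanta of `2^-8`). [folklore] -/
theorem E3M2_elemDot_exact_in_Binary32 (a b : MXBlock Format.E3M2 32) :
    ∃ z : MiniFloat Format.Binary32, z.toRat = elemDot a b :=
  exists_toRat_eq_elemDot (d := 141) (by decide) (by decide +kernel) (by decide +kernel) a b

/-- INSTANCE: the element dot product of two MXFP6 `E2M3` blocks (`k = 32`) is a `binary32` value
(`32 · 60² = 115200 < 2^24` quanta of `2^-6`). [folklore] -/
theorem E2M3_elemDot_exact_in_Binary32 (a b : MXBlock Format.E2M3 32) :
    ∃ z : MiniFloat Format.Binary32, z.toRat = elemDot a b :=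
  exists_toRat_eq_elemDot (d := 143) (by decide) (by decide +kernel) (by decide +kernel) a b

end MXBlock

end Literature.ComputerArithmetic.FloatingPoint
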